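import Literature.Analysis.FluidPDE.VeryWeakToDistributional
import HarnessLib

/-!
# Very weak solutions with the Riesz pressure are distributional solutions: the class
# `u ∈ L⁴`, `p ∈ L²` of the slab (bounded mild solutions with weak-`L³` data)

Analysis/FluidPDE proof file (theorems only: no definition, no named fact, no `sorry`) on the
discharge path of the named fact
`Literature.Analysis.FluidPDE.AlbrittonBarker2019_liouville_weakL3_backward`
(`AncientL3BackwardLiouville.lean`; Albritton–Barker, arXiv:1811.00502, Thm. 4.1). The blow-down
solutions of the proof of Thm. 4.1 are bounded mild solutions whose slices lie in
`L^{3,∞} ∩ L^∞ ⊂ L⁴`, uniformly in time, but not in `L³`; their Riesz pressure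
`p = Σ ℛᵢℛⱼ(uᵢuⱼ)` is in `L²`, not in `L^{3/2}`. The tree's
`isDistributionalNSSolutionOn_slab_of_veryWeak` (`VeryWeakToDistributional.lean`;
Lemarié-Rieusset 2016, Ch. 6, Prop. 6.5 with Lemma 6.3, (6.13), Def. 6.9) is written for the class
`u ∈ L³`, `p ∈ L^{3/2}` of the slab. This file is its twin for `u ∈ L⁴((0,S) × ℝ³)`,
`p ∈ L²((0,S) × ℝ³)`: the proof is the same word for word — the corrected divergence-free test
fields `w_r = ψ − ∇N_{r/2,r}[div ψ] − e_{r/2,r}[ψ]`, the exact pressure identity, and remainder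
terms supported on boxes of volume `O(r³)` with size `O(r⁻³)`, which vanish as `r → ∞` for any
integrability exponent `1 < q < ∞` of the slab (`tendsto_setIntegral_slab_of_bound`: the decay is
`O(r^{3/q' − 3})`); only the Hölder bookkeeping changes (`q = 4`, `q' = 4/3` for the linear terms,
`q = q' = 2` for the quadratic and the pressure terms).

* `memLp_norm_sq_of_memLp_four` — `|u|² ∈ L²` for `u ∈ L⁴`;
* `tendsto_setIntegral_pressure_mul_farSmoothing_two`,
  `tendsto_setIntegral_veryWeakIntegrand_farSmoothingField_four` — the remainder terms;
* `isDistributionalNSSolutionOn_slab_of_veryWeak_four` — the theorem.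

## References

* P. G. Lemarié-Rieusset, *The Navier–Stokes Problem in the 21st Century*, CRC Press 2016,
  Ch. 6: Def. 6.2, Lemma 6.3 (p. 126), (6.13) (p. 135), Prop. 6.5 with Def. 6.9 (p. 136).
  [`LemarieRieusset2016`]
* D. Albritton, T. Barker, arXiv:1811.00502, §4. [`AlbrittonBarker2019`]
-/

noncomputable section

open MeasureTheory Set Function Filter Metric TopologicalSpace InnerProductSpace
open _root_.Topology
open scoped ENNReal NNReal RealInnerProductSpace Laplacian

namespace Literature.Analysis.FluidPDE

local notation "ℝ³" => EuclideanSpace ℝ (Fin 3)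

/-! ### Bookkeeping for the exponents `4`, `4/3`, `2` -/

/-- `|f|² ∈ L²` for `f ∈ L⁴`. [folklore] -/
theorem memLp_norm_sq_of_memLp_four {α : Type*} [MeasurableSpace α] {μ : Measure α}
    {F : Type*} [NormedAddCommGroup F] {f : α → F} (hf : MemLp f 4 μ) :
    MemLp (fun z => ‖f z‖ ^ 2) 2 μ := by
  have h := hf.norm_rpow_div (2 : ℝ≥0∞)
  have e : (4 : ℝ≥0∞) / 2 = 2 := by
    rw [show (4 : ℝ≥0∞) = 2 * 2 by norm_num, ENNReal.mul_div_cancel_right two_ne_zero ENNReal.ofNat_ne_top]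
  rw [e] at h
  simpa [Real.rpow_two] using h

/-- `∫∫ |f|⁴ < ∞` for `f ∈ L⁴` (bookkeeping). [folklore] -/
theorem lintegral_enorm_rpow_lt_top_of_memLp_four {α : Type*} [MeasurableSpace α] {μ : Measure α}
    {F : Type*} [NormedAddCommGroup F] {f : α → F} (hf : MemLp f 4 μ) :
    ∫⁻ z, ‖f z‖ₑ ^ (4 : ℝ) ∂μ < ⊤ := by
  have h := (eLpNorm_lt_top_iff_lintegral_rpow_enorm_lt_top (by norm_num) (by norm_num)).1 hf.2
  simpa using h

/-- `∫∫ |f|² < ∞` for `f ∈ L²` (bookkeeping). [folklore] -/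
theorem lintegral_enorm_rpow_lt_top_of_memLp_two {α : Type*} [MeasurableSpace α] {μ : Measure α}
    {F : Type*} [NormedAddCommGroup F] {f : α → F} (hf : MemLp f 2 μ) :
    ∫⁻ z, ‖f z‖ₑ ^ (2 : ℝ) ∂μ < ⊤ := by
  have h := (eLpNorm_lt_top_iff_lintegral_rpow_enorm_lt_top (by norm_num) (by norm_num)).1 hf.2
  simpa using h

/-- Hölder conjugacy of the real exponents `(2, 2)`. [folklore] -/
private theorem real_holderConjugate_two_two : Real.HolderConjugate (2 : ℝ) 2 :=
  ⟨by norm_num, by norm_num, by norm_num⟩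

/-- Hölder conjugacy of the real exponents `(4, 4/3)`. [folklore] -/
private theorem real_holderConjugate_four_fourThirds : Real.HolderConjugate (4 : ℝ) (4 / 3) :=
  ⟨by norm_num, by norm_num, by norm_num⟩

/-! ### The remainder terms vanish as `r → ∞` -/

section Remainders

variable {S ν : ℝ} {u : ℝ → ℝ³ → ℝ³} {p : ℝ → ℝ³ → ℝ}

/-- **Term A (pressure in `L²`): the pressure against the smoothing remainder of `div ψ`
vanishes as `r → ∞`** (`|Λ_r[div ψ]| = O(r⁻³)` on a box of volume `O(r³)`; decay `O(r^{-3/2})`).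
[folklore] -/
theorem tendsto_setIntegral_pressure_mul_farSmoothing_two (hS : 0 < S)
    (hp : MemLp (uncurry p) 2 (volume.restrict (Ioo 0 S ×ˢ (univ : Set ℝ³))))
    {ψ : ℝ → ℝ³ → ℝ³} (hψ : IsSpaceTimeTestOn (slab ℝ³ (Ioo 0 S) isOpen_Ioo) ψ) :
    Tendsto (fun r => ∫ z in Ioo 0 S ×ˢ (univ : Set ℝ³), p z.1 z.2 *
      newtonFarSmoothing (r / 2) r (fun y => VectorCalculus.divergence (ψ z.1) y) z.2) atTop (𝓝 0) := by
  obtain ⟨a, b, R₀, -, -, hR₀, hT⟩ := hψ.exists_tsupport_subset_box hS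
  have hg := (hψ.mono le_top).divergence_isSpaceTimeTestOn
  obtain ⟨C, hC0, hC⟩ := exists_abs_newtonFarSmoothing_slice_le hg
  obtain ⟨-, hg0⟩ := hψ.continuous_divergence_field
  have hg0' : ∀ t y, (t, y) ∉ Icc a b ×ˢ closedBall (0 : ℝ³) R₀ →
      VectorCalculus.divergence (ψ t) y = 0 := fun t y hty => hg0 (t, y) fun h => hty (hT h)
  refine tendsto_setIntegral_slab_of_bound (F := uncurry p) (r₁ := 1) (a := a) (b := b) (C := C)
    real_holderConjugate_two_two hp.1.aemeasurable.enorm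
    (lintegral_enorm_rpow_lt_top_of_memLp_two hp) hR₀ (fun r hr z _ => ?_) (fun r hr z hz => ?_)
  · rw [norm_mul]
    exact mul_le_mul_of_nonneg_left (hC (one_pos.trans_le hr) z.1 z.2) (norm_nonneg _)
  · rw [newtonFarSmoothing_slice_eq_zero_of_notMem hg0' (one_pos.trans_le hr) hz, mul_zero]

/-- **Terms B, C, D (velocity in `L⁴`): the very weak integrand against the corrector `e_r[ψ]`
vanishes as `r → ∞`** (`∂ₜe_r = e_r[∂ₜψ]`, `Δe_r = e_r[Δψ]` are `O(r⁻³)`, decay `O(r^{-3/4})`; the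
convective pairing is `|u|² O(r⁻³)` with `|u|² ∈ L²`, decay `O(r^{-3/2})`). [folklore] -/
theorem tendsto_setIntegral_veryWeakIntegrand_farSmoothingField_four (hS : 0 < S)
    (hu : MemLp (uncurry u) 4 (volume.restrict (Ioo 0 S ×ˢ (univ : Set ℝ³))))
    {ψ : ℝ → ℝ³ → ℝ³} (hψ : IsSpaceTimeTestOn (slab ℝ³ (Ioo 0 S) isOpen_Ioo) ψ) (ν : ℝ) :
    Tendsto (fun r => ∫ z in Ioo 0 S ×ˢ (univ : Set ℝ³),
      veryWeakIntegrand ν u (fun t x => farSmoothingField (r / 2) r (ψ t) x) z) atTop (𝓝 0) := by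
  obtain ⟨a, b, R₀, -, -, hR₀, hT⟩ := hψ.exists_tsupport_subset_box hS
  have hψ' : IsSpaceTimeTestOn (⊤ : Opens (ℝ × ℝ³)) ψ := hψ.mono le_top
  have hu1 : LocallyIntegrableOn (uncurry u)
      ((slab ℝ³ (Ioo 0 S) isOpen_Ioo : Opens (ℝ × ℝ³)) : Set (ℝ × ℝ³)) volume :=
    locallyIntegrableOn_slab_of_memLp hu (by norm_num)
  have hu2m := memLp_norm_sq_of_memLp_four hu
  have hu2 : LocallyIntegrableOn (fun z => ‖uncurry u z‖ ^ 2)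
      ((slab ℝ³ (Ioo 0 S) isOpen_Ioo : Opens (ℝ × ℝ³)) : Set (ℝ × ℝ³)) volume :=
    locallyIntegrableOn_slab_of_memLp hu2m (by norm_num)
  have hum : AEMeasurable (fun z => ‖uncurry u z‖ₑ) (volume.restrict (Ioo 0 S ×ˢ (univ : Set ℝ³))) :=
    hu.1.aemeasurable.enorm
  have hu4 := lintegral_enorm_rpow_lt_top_of_memLp_four hu
  -- the derived test fields and their supports
  have hdt := hψ'.timeDeriv_top
  have hlap := hψ'.laplacian_top
  have hdt0 : ∀ t y, (t, y) ∉ Icc a b ×ˢ closedBall (0 : ℝ³) R₀ → timeDeriv ψ t y = 0 :=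
    fun t y hty => IsSpaceTimeTestOn.timeDeriv_eq_zero_of_notMem (ψ := ψ) fun h => hty (hT h)
  have hlap0 : ∀ t y, (t, y) ∉ Icc a b ×ˢ closedBall (0 : ℝ³) R₀ → Δ (ψ t) y = 0 :=
    fun t y hty => laplacian_slice_eq_zero_of_notMem_tsupport fun h => hty (hT h)
  obtain ⟨C₁, hC₁0, hC₁⟩ := exists_norm_farSmoothingField_slice_le hdt
  obtain ⟨C₂, hC₂0, hC₂⟩ := exists_abs_inner_fderiv_farSmoothingField_le hψ'
  obtain ⟨C₃, hC₃0, hC₃⟩ := exists_norm_farSmoothingField_slice_le hlap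
  -- the three limits
  have hB : Tendsto (fun r => ∫ z in Ioo 0 S ×ˢ (univ : Set ℝ³),
      ⟪u z.1 z.2, timeDeriv (fun t x => farSmoothingField (r / 2) r (ψ t) x) z.1 z.2⟫) atTop (𝓝 0) := by
    refine tendsto_setIntegral_slab_of_bound (F := uncurry u) (r₁ := 1) (a := a) (b := b) (C := C₁)
      real_holderConjugate_four_fourThirds hum hu4 hR₀ (fun r hr z _ => ?_) (fun r hr z hz => ?_)
    · have hr0 : 0 < r := one_pos.trans_le hr
      rw [timeDeriv_farSmoothingField (half_pos hr0) (half_lt_self hr0) hψ']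
      exact (norm_inner_le_norm _ _).trans (mul_le_mul_of_nonneg_left (hC₁ hr0 _ _) (norm_nonneg _))
    · have hr0 : 0 < r := one_pos.trans_le hr
      rw [timeDeriv_farSmoothingField (half_pos hr0) (half_lt_self hr0) hψ',
        farSmoothingField_slice_eq_zero_of_notMem hdt0 hr0 hz, inner_zero_right]
  have hC : Tendsto (fun r => ∫ z in Ioo 0 S ×ˢ (univ : Set ℝ³),
      ⟪u z.1 z.2, convect (u z.1) (fun x => farSmoothingField (r / 2) r (ψ z.1) x) z.2⟫) atTop (𝓝 0) := by
    refine tendsto_setIntegral_slab_of_bound (F := fun z => ‖uncurry u z‖ ^ 2) (r₁ := 1) (a := a)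
      (b := b) (C := C₂) real_holderConjugate_two_two hu2m.1.aemeasurable.enorm
      (lintegral_enorm_rpow_lt_top_of_memLp_two hu2m) hR₀
      (fun r hr z _ => ?_) (fun r hr z hz => ?_)
    · have hr0 : 0 < r := one_pos.trans_le hr
      rw [convect, Real.norm_eq_abs]
      refine (hC₂ hr0 z.1 z.2 (u z.1 z.2)).trans (le_of_eq ?_)
      simp [uncurry]
    · have hr0 : 0 < r := one_pos.trans_le hr
      exact inner_fderiv_farSmoothingField_eq_zero_of_notMem hψ' hT hr0 hz _
  have hD : Tendsto (fun r => ∫ z in Ioo 0 S ×ˢ (univ : Set ℝ³),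
      ν * ⟪u z.1 z.2, Δ (fun x => farSmoothingField (r / 2) r (ψ z.1) x) z.2⟫) atTop (𝓝 0) := by
    refine tendsto_setIntegral_slab_of_bound (F := uncurry u) (r₁ := 1) (a := a) (b := b)
      (C := |ν| * C₃) real_holderConjugate_four_fourThirds hum hu4 hR₀ (fun r hr z _ => ?_)
      (fun r hr z hz => ?_)
    · have hr0 : 0 < r := one_pos.trans_le hr
      have hψ2 : ContDiff ℝ 2 (ψ z.1) := (hψ.contDiff_slice z.1).of_le (by norm_cast)
      rw [show (fun x => farSmoothingField (r / 2) r (ψ z.1) x) = farSmoothingField (r / 2) r (ψ z.1)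
        from rfl, laplacian_farSmoothingField (half_pos hr0) (half_lt_self hr0) hψ2, norm_mul,
        Real.norm_eq_abs, mul_div_assoc, mul_left_comm]
      refine mul_le_mul_of_nonneg_left ?_ (abs_nonneg _)
      exact (norm_inner_le_norm _ _).trans (mul_le_mul_of_nonneg_left (hC₃ hr0 _ _) (norm_nonneg _))
    · have hr0 : 0 < r := one_pos.trans_le hr
      have hψ2 : ContDiff ℝ 2 (ψ z.1) := (hψ.contDiff_slice z.1).of_le (by norm_cast)
      rw [show (fun x => farSmoothingField (r / 2) r (ψ z.1) x) = farSmoothingField (r / 2) r (ψ z.1)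
        from rfl, laplacian_farSmoothingField (half_pos hr0) (half_lt_self hr0) hψ2,
        farSmoothingField_slice_eq_zero_of_notMem hlap0 hr0 hz, inner_zero_right, mul_zero]
  -- assembling: for `r > 0` the integral splits
  have hsum := (hB.add hC).add hD
  rw [add_zero, add_zero] at hsum
  refine hsum.congr' ?_
  filter_upwards [eventually_gt_atTop 0] with r hr
  have he := isSpaceTimeTestOn_farSmoothingField_slab hS hψ (half_pos hr) (half_lt_self hr)
  obtain ⟨I1, I2, I3⟩ := integrable_veryWeak_terms hu1 hu2 he ν
  simp only [veryWeakIntegrand_apply]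
  rw [integral_add (f := fun z : ℝ × ℝ³ =>
      ⟪u z.1 z.2, timeDeriv (fun t x => farSmoothingField (r / 2) r (ψ t) x) z.1 z.2⟫ +
        ⟪u z.1 z.2, convect (u z.1) (fun x => farSmoothingField (r / 2) r (ψ z.1) x) z.2⟫)
      (g := fun z : ℝ × ℝ³ => ν * ⟪u z.1 z.2, Δ (fun x => farSmoothingField (r / 2) r (ψ z.1) x) z.2⟫)
      (I1.integrableOn.add I2.integrableOn) I3.integrableOn,
    integral_add I1.integrableOn I2.integrableOn]

end Remainders

/-! ### The theorem -/

section Main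

variable {S ν : ℝ} {u : ℝ → ℝ³ → ℝ³} {p : ℝ → ℝ³ → ℝ}

/-- **Very weak solutions in `L⁴` of the slab with the Riesz pressure in `L²` are distributional
solutions** (Lemarié-Rieusset 2016, Ch. 6, Prop. 6.5 with Lemma 6.3, (6.13) and Def. 6.9, for
this integrability class; twin of `isDistributionalNSSolutionOn_slab_of_veryWeak`). Let
`u ∈ L⁴((0,S) × ℝ³)` and `p ∈ L²((0,S) × ℝ³)` satisfy on the open slab `Q = (0, S) × ℝ³`:
`div u = 0` weakly, the weak pressure Poisson equation `∫∫_Q p Δθ = -∫∫_Q D²θ(u, u)`, and the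
very weak (pressure-free) momentum equation against test fields with divergence-free slices.
Then `(u, p)` is a distributional solution of the unforced Navier–Stokes equations on `Q`.
[cite: LemarieRieusset2016, Def. 6.2 with Lemma 6.3 (file p. 126), (6.13) (p. 135), Prop. 6.5 with Def. 6.9 (p. 136)] -/
theorem isDistributionalNSSolutionOn_slab_of_veryWeak_four
    (hu : MemLp (uncurry u) 4 (volume.restrict (Ioo 0 S ×ˢ (univ : Set ℝ³))))
    (hp : MemLp (uncurry p) 2 (volume.restrict (Ioo 0 S ×ˢ (univ : Set ℝ³))))
    (hdiv : ∀ θ : ℝ → ℝ³ → ℝ, IsSpaceTimeTestOn (slab ℝ³ (Ioo 0 S) isOpen_Ioo) θ →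
      ∫ z in Ioo 0 S ×ˢ (univ : Set ℝ³), ⟪u z.1 z.2, gradient (θ z.1) z.2⟫ = 0)
    (hpois : ∀ θ : ℝ → ℝ³ → ℝ, IsSpaceTimeTestOn (slab ℝ³ (Ioo 0 S) isOpen_Ioo) θ →
      ∫ z in Ioo 0 S ×ˢ (univ : Set ℝ³), p z.1 z.2 * Δ (θ z.1) z.2 =
        -∫ z in Ioo 0 S ×ˢ (univ : Set ℝ³), fderiv ℝ (fderiv ℝ (θ z.1)) z.2 (u z.1 z.2) (u z.1 z.2))
    (hweak : ∀ ψ : ℝ → ℝ³ → ℝ³, IsSpaceTimeTestOn (slab ℝ³ (Ioo 0 S) isOpen_Ioo) ψ →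
      (∀ t, VectorCalculus.IsDivFree (ψ t)) →
      ∫ z in Ioo 0 S ×ˢ (univ : Set ℝ³), (⟪u z.1 z.2, timeDeriv ψ z.1 z.2⟫ +
        ⟪u z.1 z.2, convect (u z.1) (ψ z.1) z.2⟫ + ν * ⟪u z.1 z.2, Δ (ψ z.1) z.2⟫) = 0) :
    IsDistributionalNSSolutionOn (slab ℝ³ (Ioo 0 S) isOpen_Ioo) ν 0 u p := by
  have hQ : ((slab ℝ³ (Ioo 0 S) isOpen_Ioo : Opens (ℝ × ℝ³)) : Set (ℝ × ℝ³)) =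
      Ioo 0 S ×ˢ (univ : Set ℝ³) := rfl
  have hu1 : LocallyIntegrableOn (uncurry u)
      ((slab ℝ³ (Ioo 0 S) isOpen_Ioo : Opens (ℝ × ℝ³)) : Set (ℝ × ℝ³)) volume :=
    locallyIntegrableOn_slab_of_memLp hu (by norm_num)
  have hu2 : LocallyIntegrableOn (fun z => ‖uncurry u z‖ ^ 2)
      ((slab ℝ³ (Ioo 0 S) isOpen_Ioo : Opens (ℝ × ℝ³)) : Set (ℝ × ℝ³)) volume :=
    locallyIntegrableOn_slab_of_memLp (memLp_norm_sq_of_memLp_four hu) (by norm_num)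
  have hp1 : LocallyIntegrableOn (uncurry p)
      ((slab ℝ³ (Ioo 0 S) isOpen_Ioo : Opens (ℝ × ℝ³)) : Set (ℝ × ℝ³)) volume :=
    locallyIntegrableOn_slab_of_memLp hp (by norm_num)
  refine ⟨hu1, hu2, hp1, fun θ hθ => hdiv θ hθ, fun ψ hψ => ?_⟩
  rw [hQ]
  -- the degenerate slab
  rcases le_or_gt S 0 with hS | hS
  · rw [Ioo_eq_empty_of_le hS, empty_prod, Measure.restrict_empty, integral_zero_measure]
  -- notation
  set g : ℝ → ℝ³ → ℝ := fun t x => VectorCalculus.divergence (ψ t) x with hg_def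
  have hg : IsSpaceTimeTestOn (slab ℝ³ (Ioo 0 S) isOpen_Ioo) g := hψ.divergence_isSpaceTimeTestOn
  -- the target integrand is `W(ψ) + p g`
  have hint : ∀ z : ℝ × ℝ³, ⟪u z.1 z.2, timeDeriv ψ z.1 z.2⟫ + ⟪u z.1 z.2, convect (u z.1) (ψ z.1) z.2⟫ +
      ν * ⟪u z.1 z.2, Δ (ψ z.1) z.2⟫ + p z.1 z.2 * VectorCalculus.divergence (ψ z.1) z.2 +
      ⟪(0 : ℝ → ℝ³ → ℝ³) z.1 z.2, ψ z.1 z.2⟫ = veryWeakIntegrand ν u ψ z + p z.1 z.2 * g z.1 z.2 := by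
    intro z
    simp only [veryWeakIntegrand_apply, hg_def, Pi.zero_apply, inner_zero_left, add_zero]
  simp_rw [hint]
  -- integrability of `W(ψ)` and `p g`
  have IW := integrable_veryWeakIntegrand hu1 hu2 hψ ν
  obtain ⟨cg, hg0⟩ := hψ.continuous_divergence_field
  have Ipg : Integrable (fun z : ℝ × ℝ³ => p z.1 z.2 * g z.1 z.2) (volume : Measure (ℝ × ℝ³)) :=
    integrable_mul_of_locallyIntegrableOn (F := uncurry p) hp1 cg hψ.hasCompactSupport
      hψ.tsupport_subset hg0
  rw [integral_add IW.integrableOn Ipg.integrableOn]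
  -- the key identity at scale `r > 0`
  have key : ∀ r : ℝ, 0 < r →
      (∫ z in Ioo 0 S ×ˢ (univ : Set ℝ³), veryWeakIntegrand ν u ψ z) +
        ∫ z in Ioo 0 S ×ˢ (univ : Set ℝ³), p z.1 z.2 * g z.1 z.2 =
      (∫ z in Ioo 0 S ×ˢ (univ : Set ℝ³), p z.1 z.2 * newtonFarSmoothing (r / 2) r (g z.1) z.2) +
        ∫ z in Ioo 0 S ×ˢ (univ : Set ℝ³),
          veryWeakIntegrand ν u (fun t x => farSmoothingField (r / 2) r (ψ t) x) z := by
    intro r hr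
    have h₀ : 0 < r / 2 := half_pos hr
    have h₁ : r / 2 < r := half_lt_self hr
    -- the pieces of `w_r`
    have hφ : IsSpaceTimeTestOn (slab ℝ³ (Ioo 0 S) isOpen_Ioo)
        (fun t => newtonNearPotential (r / 2) r (g t)) := hg.newtonNearPotential_slab hS h₀.le h₁
    have hΛ : IsSpaceTimeTestOn (slab ℝ³ (Ioo 0 S) isOpen_Ioo)
        (fun t => newtonFarSmoothing (r / 2) r (g t)) := hg.newtonFarSmoothing_slab hS h₀ h₁
    have hgradφ := hφ.gradient_isSpaceTimeTestOn
    have he := isSpaceTimeTestOn_farSmoothingField_slab hS hψ h₀ h₁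
    have hw := isSpaceTimeTestOn_correctedTestField hS hψ hr
    -- `hweak` for `w_r`, split into three integrals
    have hzero := hweak (correctedTestField r ψ) hw (isDivFree_correctedTestField hψ hr)
    have hsplit : ∀ z : ℝ × ℝ³, ⟪u z.1 z.2, timeDeriv (correctedTestField r ψ) z.1 z.2⟫ +
        ⟪u z.1 z.2, convect (u z.1) (correctedTestField r ψ z.1) z.2⟫ +
        ν * ⟪u z.1 z.2, Δ (correctedTestField r ψ z.1) z.2⟫ =
        veryWeakIntegrand ν u ψ z -
          veryWeakIntegrand ν u (fun t x => gradient (newtonNearPotential (r / 2) r (g t)) x) z -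
          veryWeakIntegrand ν u (fun t x => farSmoothingField (r / 2) r (ψ t) x) z := by
      intro z
      rw [← veryWeakIntegrand_apply, ← veryWeakIntegrand_sub hψ hgradφ z,
        ← veryWeakIntegrand_sub (hψ.sub hgradφ) he z]
      rfl
    simp_rw [hsplit] at hzero
    have IW1 := integrable_veryWeakIntegrand hu1 hu2 hgradφ ν
    have IW2 := integrable_veryWeakIntegrand hu1 hu2 he ν
    rw [integral_sub (f := fun z => veryWeakIntegrand ν u ψ z -
        veryWeakIntegrand ν u (fun t x => gradient (newtonNearPotential (r / 2) r (g t)) x) z)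
        (g := veryWeakIntegrand ν u (fun t x => farSmoothingField (r / 2) r (ψ t) x))
        (IW.integrableOn.sub IW1.integrableOn) IW2.integrableOn,
      integral_sub IW.integrableOn IW1.integrableOn] at hzero
    have hG := setIntegral_veryWeakIntegrand_gradient (ν := ν) hu1 hu2 hdiv hpois hφ
    rw [hQ] at hG
    rw [hG] at hzero
    -- the pressure against `ΔN[g] = g - Λ[g]`
    obtain ⟨cΛ, hΛ0'⟩ := (show Continuous (uncurry fun t => newtonFarSmoothing (r / 2) r (g t)) ∧
        ∀ z : ℝ × ℝ³, z ∉ tsupport (uncurry fun t => newtonFarSmoothing (r / 2) r (g t)) →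
          newtonFarSmoothing (r / 2) r (g z.1) z.2 = 0 from
      ⟨hΛ.contDiff.continuous, fun z hz =>
        show uncurry (fun t => newtonFarSmoothing (r / 2) r (g t)) z = 0 from
          image_eq_zero_of_notMem_tsupport hz⟩)
    have IpΛ : Integrable (fun z : ℝ × ℝ³ => p z.1 z.2 * newtonFarSmoothing (r / 2) r (g z.1) z.2)
        (volume : Measure (ℝ × ℝ³)) :=
      integrable_mul_of_locallyIntegrableOn (F := uncurry p) hp1 cΛ hΛ.hasCompactSupport
        hΛ.tsupport_subset hΛ0'
    have hlapN : ∀ z : ℝ × ℝ³, p z.1 z.2 * Δ (newtonNearPotential (r / 2) r (g z.1)) z.2 =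
        p z.1 z.2 * g z.1 z.2 - p z.1 z.2 * newtonFarSmoothing (r / 2) r (g z.1) z.2 := by
      intro z
      rw [laplacian_newtonNearPotential h₀ h₁ ((hg.contDiff_slice z.1).of_le (by norm_cast)), mul_sub]
    simp_rw [hlapN] at hzero
    rw [integral_sub Ipg.integrableOn IpΛ.integrableOn] at hzero
    linarith
  -- the remainder vanishes
  have hlim := (tendsto_setIntegral_pressure_mul_farSmoothing_two hS hp hψ).add
    (tendsto_setIntegral_veryWeakIntegrand_farSmoothingField_four hS hu hψ ν)
  rw [add_zero] at hlim
  have hconst : Tendsto (fun _ : ℝ => (∫ z in Ioo 0 S ×ˢ (univ : Set ℝ³), veryWeakIntegrand ν u ψ z) +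
      ∫ z in Ioo 0 S ×ˢ (univ : Set ℝ³), p z.1 z.2 * g z.1 z.2) atTop (𝓝 0) := by
    refine hlim.congr' ?_
    filter_upwards [eventually_gt_atTop 0] with r hr
    exact (key r hr).symm
  exact tendsto_nhds_unique tendsto_const_nhds hconst

end Main

end Literature.Analysis.FluidPDE

end
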